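import Literature.NumberTheory.SerreUniformity.Statement
import HarnessLib

/-!
# Route `QuadraticBranchSignedControl` (rung K8, cell `bsd-potss`): crux stmt-BirchSwinnertonDyer-19606
# `PlusEtaMainConjectureNonsurj` — matrix algebra of the normaliser of a non-split Cartan subgroup
# (Mathlib + the dossier sets `SerreUniformity.nonsplitCartan ε ⊂ nonsplitCartanNormalizer ε` only)

WHY (crux 19606, skeleton v5 `Cruxes/PlusEtaMainConjectureNonsurj/Lines/birth.lean`, stubs
`stub_etaMC_nonCM_upper` / `stub_etaMC_nonCM_lower`; v7 candidate `stub_etaMC_nonCM_uncongruent`). The rows of the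
crux are EXACTLY the `ℚ`-points of `X_ns⁺(p)` (`not_forall_surj_pow_iff_cartanNormalizer`, p448914): in a basis `e` of
`V[p]` the Galois group acts through the explicit set `C_ns⁺(ε)` of matrices `(a, εb; b, a)` (the Cartan `C_ns(ε) ≅ 𝔽_{p²}ˣ`)
and `(a, −εb; b, −a)` (its non-trivial coset, acting on `𝔽_p[√ε]` through Frobenius). Every road the cell has to the
NON-CM rows is a TRANSFER along a mod-`p` congruence from an ANCHOR (a CM curve, FINDING-19606-k8eta-c2-g8; a unit row,
g3/g5), and the obstruction to a CM anchor is the CARTAN FIELD `K_V` cut out by `ρ̄⁻¹(C_ns)` (FINDING g5 §2). This file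
is the matrix algebra behind the kernel treatment of `K_V` (companion file `…PlusEtaNonsurjCartanField.lean`):

* §1 the two kinds of elements of `C_ns⁺(ε)` — `(a, εb; b, a) ∈ C_ns(ε)` and `(c, −εd; d, −c)` — are DISJOINT
  (`coset_not_mem_nonsplitCartan`, `exists_eq_coset_of_not_mem_nonsplitCartan`; `p ≠ 2`);
* §2 closure: `mul_mem_nonsplitCartan`, `mul_mem_nonsplitCartan_of_not_mem_of_not_mem` (second kind × second kind
  ⊂ `C_ns`), `sq_mem_nonsplitCartan_of_mem_normalizer` (every SQUARE of `C_ns⁺(ε)` lies in `C_ns(ε)`),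
  `mul_comm_of_mem_nonsplitCartan` (the Cartan is commutative),
  `coset_mul_cartanShape` (the second kind conjugates `u + v√ε` to `u − v√ε`), `eq_cartanShape_of_commute` (the
  commutant of a non-scalar Cartan element is `𝔽_p[√ε]`), cancellation lemmas;
* §3 rigidity: `eq_zero_of_coset_commute` / `apply_one_zero_eq_zero_of_commute` — an element of the second kind
  commutes with `(a, εb; b, a)` only if `b = 0`; `diag_mem_nonsplitCartanNormalizer`, `diag_not_mem_nonsplitCartan`
  (`(1, 0; 0, −1)` witnesses `C_ns ≠ C_ns⁺`); the test element `x = (1, ε; 1, 1) ∈ C_ns(ε)` with `x²` off the scalars;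
* §4 `eq_one_of_unipotent_of_mem_nonsplitCartanNormalizer` — **`C_ns⁺(ε)` contains no transvection**: `(M − 1)² = 0`
  forces `M = 1`. This one group fact is why BOTH in-print integral Euler-system handles are idle on every row of the
  crux: Kato's Thm. 13.4 clause (3) wants `σ ∈ Gal(ℚ̄/ℚ(μ_{p^∞}))` with `T/(σ − 1)T ≅ ℤ_p`, i.e. a transvection mod `p`
  [cite: Kato2004Asterisque, Thm. 13.4 (3) (p. 226)]; Fouquet–Wan's Thm. 1.1 (arXiv:2107.13726) wants a prime `ℓ ∥ N`
  with `dim ρ̄^{I_ℓ} = 1`, i.e. a unipotent inertia image of order `p` — neither exists when the image is `C_ns⁺(p)`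
  (order `2(p² − 1)`, prime to `p`).

HONEST FRAMING (cell `bsd-potss`, run/shared/lean/pub/bsd-potss/): TOOL LEMMAS ONLY (Mathlib-level matrix algebra over
`ZMod p`; no definition, no named fact, no `sorry`, axioms standard).
Nothing about BSD is claimed; crux 19606 stays OPEN. Seat `bsd-potss-k8eta-c2` g9 (prover),
`--supports stmt-BirchSwinnertonDyer-19606`.

References: [Serre1972] §2.2 (`(N : C) = 2`, the coset acts by Frobenius); [FurioLombardo2023] (1.1);
[Kato2004Asterisque] Thm. 13.4 (3); O. Fouquet, X. Wan, arXiv:2107.13726, Thm. 1.1 (third hypothesis).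
-/

set_option autoImplicit false
set_option linter.dupNamespace false

noncomputable section

open scoped Classical

open Matrix Literature.NumberTheory.SerreUniformity

namespace Summit.BirchSwinnertonDyer.BirchSwinnertonDyer.Theorems.EtaCartanField

variable {p : ℕ} [hp : Fact p.Prime]

/-! ## §1 The two cosets of `C_ns(ε)` in `C_ns⁺(ε)` -/

/-- `2 ≠ 0` in `ZMod p` for `p ≠ 2` (Mathlib's `Ring.two_ne_zero`; private alias). [folklore] -/
private theorem two_ne_zero_of_ne_two (hp2 : p ≠ 2) : (2 : ZMod p) ≠ 0 :=
  Ring.two_ne_zero (by rw [ZMod.ringChar_zmod_n]; exact hp2)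

/-- A non-square is non-zero. [folklore] -/
private theorem ne_zero_of_not_isSquare {ε : ZMod p} (hε : ¬ IsSquare ε) : ε ≠ 0 :=
  fun h => hε ⟨0, by simp [h]⟩

/-- **The two cosets are disjoint** (`p` odd, `ε ≠ 0`): no matrix of the second kind `(c, −εd; d, −c)`, `(c, d) ≠ (0,0)`,
lies in `C_ns(ε)` — comparing with `(a, εb; b, a)` gives `c = a = −c` and `εd = −εb = −εd`. [cite: Serre1972, §2.2] -/
theorem coset_not_mem_nonsplitCartan (hp2 : p ≠ 2) {ε : ZMod p} (hε : ¬ IsSquare ε) {c d : ZMod p}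
    (hcd : (c, d) ≠ (0, 0)) :
    (!![c, -(ε * d); d, -c] : Matrix (Fin 2) (Fin 2) (ZMod p)) ∉ nonsplitCartan ε := by
  rintro ⟨a, b, -, hMc⟩
  have h2 := two_ne_zero_of_ne_two hp2
  have hε0 := ne_zero_of_not_isSquare hε
  have h00 := congrArg (fun N : Matrix (Fin 2) (Fin 2) (ZMod p) => N 0 0) hMc
  have h11 := congrArg (fun N : Matrix (Fin 2) (Fin 2) (ZMod p) => N 1 1) hMc
  have h10 := congrArg (fun N : Matrix (Fin 2) (Fin 2) (ZMod p) => N 1 0) hMc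
  have h01 := congrArg (fun N : Matrix (Fin 2) (Fin 2) (ZMod p) => N 0 1) hMc
  simp only [Matrix.of_apply, Matrix.cons_val', Matrix.cons_val_zero, Matrix.cons_val_one,
    Matrix.cons_val_fin_one] at h00 h11 h10 h01
  have hc : c = 0 := by
    have : (2 : ZMod p) * c = 0 := by linear_combination h00 - h11
    rcases mul_eq_zero.mp this with h | h
    · exact absurd h h2
    · exact h
  have hd : d = 0 := by
    have : (2 : ZMod p) * (ε * d) = 0 := by linear_combination ε * h10 - h01
    rcases mul_eq_zero.mp this with h | h
    · exact absurd h h2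
    · rcases mul_eq_zero.mp h with h' | h'
      · exact absurd h' hε0
      · exact h'
  exact hcd (by rw [hc, hd])

/-- **Dichotomy**: an element of `C_ns⁺(ε)` outside `C_ns(ε)` is of the second kind `(c, −εd; d, −c)`.
[cite: Serre1972, §2.2] -/
theorem exists_eq_coset_of_not_mem_nonsplitCartan {ε : ZMod p} {M : Matrix (Fin 2) (Fin 2) (ZMod p)}
    (hM : M ∈ nonsplitCartanNormalizer ε) (hM' : M ∉ nonsplitCartan ε) :
    ∃ c d : ZMod p, (c, d) ≠ (0, 0) ∧ M = !![c, -(ε * d); d, -c] := by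
  obtain ⟨a, b, hab, rfl | rfl⟩ := hM
  · exact absurd ⟨a, b, hab, rfl⟩ hM'
  · exact ⟨a, b, hab, rfl⟩

/-! ## §2 Closure: products, squares, commutativity of the Cartan -/

omit hp in
/-- Two `2 × 2` matrix literals with equal entries are equal. [folklore] -/
private theorem mat_eq {a b c d a' b' c' d' : ZMod p} (h₁ : a = a') (h₂ : b = b') (h₃ : c = c')
    (h₄ : d = d') :
    (!![a, b; c, d] : Matrix (Fin 2) (Fin 2) (ZMod p)) = !![a', b'; c', d'] := by
  subst h₁ h₂ h₃ h₄; rfl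

omit hp in
/-- Entry extraction for `2 × 2` matrix literals (simp helper). [folklore] -/
private theorem entries_eq {a b c d a' b' c' d' : ZMod p}
    (h : (!![a, b; c, d] : Matrix (Fin 2) (Fin 2) (ZMod p)) = !![a', b'; c', d']) :
    a = a' ∧ b = b' ∧ c = c' ∧ d = d' := by
  have h00 := congrArg (fun N : Matrix (Fin 2) (Fin 2) (ZMod p) => N 0 0) h
  have h01 := congrArg (fun N : Matrix (Fin 2) (Fin 2) (ZMod p) => N 0 1) h
  have h10 := congrArg (fun N : Matrix (Fin 2) (Fin 2) (ZMod p) => N 1 0) h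
  have h11 := congrArg (fun N : Matrix (Fin 2) (Fin 2) (ZMod p) => N 1 1) h
  simp only [Matrix.of_apply, Matrix.cons_val', Matrix.cons_val_zero, Matrix.cons_val_one,
    Matrix.cons_val_fin_one] at h00 h01 h10 h11
  exact ⟨h00, h01, h10, h11⟩

/-- For `ε` a non-square, `(a, b) ≠ (0,0)` iff `a² − εb² ≠ 0` — the "nonzero" side used to re-pack products.
[folklore] -/
theorem pair_ne_zero_of_norm_ne_zero {ε a b : ZMod p} (h : a * a - ε * b * b ≠ 0) : (a, b) ≠ (0, 0) := by
  rintro hab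
  simp only [Prod.mk.injEq] at hab
  obtain ⟨rfl, rfl⟩ := hab
  exact h (by ring)

/-- **`C_ns(ε)` is closed under multiplication**: `(a + b√ε)(c + d√ε) = (ac + εbd) + (ad + bc)√ε`, and the product of
two elements of non-zero norm has non-zero norm. [cite: Serre1972, §2.1] -/
theorem mul_mem_nonsplitCartan {ε : ZMod p} (hε : ¬ IsSquare ε) {M N : Matrix (Fin 2) (Fin 2) (ZMod p)}
    (hM : M ∈ nonsplitCartan ε) (hN : N ∈ nonsplitCartan ε) : M * N ∈ nonsplitCartan ε := by
  obtain ⟨a, b, hab, rfl⟩ := hM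
  obtain ⟨c, d, hcd, rfl⟩ := hN
  refine ⟨a * c + ε * b * d, a * d + b * c, ?_, ?_⟩
  · apply pair_ne_zero_of_norm_ne_zero (ε := ε)
    have h1 := sq_sub_mul_sq_ne_zero hε hab
    have h2 := sq_sub_mul_sq_ne_zero hε hcd
    have : (a * c + ε * b * d) * (a * c + ε * b * d) - ε * (a * d + b * c) * (a * d + b * c) =
        (a * a - ε * b * b) * (c * c - ε * d * d) := by ring
    rw [this]
    exact mul_ne_zero h1 h2
  · rw [Matrix.mul_fin_two]
    exact mat_eq (by ring) (by ring) (by ring) (by ring)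

/-- **The product of two elements of the second kind lies in `C_ns(ε)`** (`(z ↦ u z̄) ∘ (z ↦ v z̄) = (z ↦ u v̄ z)`):
`(a, −εb; b, −a)(c, −εd; d, −c) = (ac − εbd, ε(bc − ad); bc − ad, ac − εbd)`. [cite: Serre1972, §2.2] -/
theorem coset_mul_coset_mem_nonsplitCartan {ε : ZMod p} (hε : ¬ IsSquare ε) {a b c d : ZMod p}
    (hab : (a, b) ≠ (0, 0)) (hcd : (c, d) ≠ (0, 0)) :
    (!![a, -(ε * b); b, -a] * !![c, -(ε * d); d, -c] : Matrix (Fin 2) (Fin 2) (ZMod p)) ∈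
      nonsplitCartan ε := by
  refine ⟨a * c - ε * b * d, b * c - a * d, ?_, ?_⟩
  · apply pair_ne_zero_of_norm_ne_zero (ε := ε)
    have h1 := sq_sub_mul_sq_ne_zero hε hab
    have h2 := sq_sub_mul_sq_ne_zero hε hcd
    have : (a * c - ε * b * d) * (a * c - ε * b * d) - ε * (b * c - a * d) * (b * c - a * d) =
        (a * a - ε * b * b) * (c * c - ε * d * d) := by ring
    rw [this]
    exact mul_ne_zero h1 h2
  · rw [Matrix.mul_fin_two]
    exact mat_eq (by ring) (by ring) (by ring) (by ring)

/-- **The product of two elements of `C_ns⁺(ε) ∖ C_ns(ε)` lies in `C_ns(ε)`** (`(C_ns⁺ : C_ns) = 2`).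
[cite: Serre1972, §2.2] -/
theorem mul_mem_nonsplitCartan_of_not_mem_of_not_mem {ε : ZMod p} (hε : ¬ IsSquare ε)
    {M N : Matrix (Fin 2) (Fin 2) (ZMod p)} (hM : M ∈ nonsplitCartanNormalizer ε) (hM' : M ∉ nonsplitCartan ε)
    (hN : N ∈ nonsplitCartanNormalizer ε) (hN' : N ∉ nonsplitCartan ε) : M * N ∈ nonsplitCartan ε := by
  obtain ⟨a, b, hab, rfl⟩ := exists_eq_coset_of_not_mem_nonsplitCartan hM hM'
  obtain ⟨c, d, hcd, rfl⟩ := exists_eq_coset_of_not_mem_nonsplitCartan hN hN'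
  exact coset_mul_coset_mem_nonsplitCartan hε hab hcd

/-- **Every square of `C_ns⁺(ε)` lies in `C_ns(ε)`.** [cite: Serre1972, §2.2] -/
theorem sq_mem_nonsplitCartan_of_mem_normalizer {ε : ZMod p} (hε : ¬ IsSquare ε)
    {M : Matrix (Fin 2) (Fin 2) (ZMod p)} (hM : M ∈ nonsplitCartanNormalizer ε) :
    M * M ∈ nonsplitCartan ε := by
  by_cases h : M ∈ nonsplitCartan ε
  · exact mul_mem_nonsplitCartan hε h h
  · exact mul_mem_nonsplitCartan_of_not_mem_of_not_mem hε hM h hM h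

/-- Matrices of the CARTAN SHAPE `(u, εv; v, u)` (the `𝔽_p`-algebra `𝔽_p[√ε] = C_ns(ε) ∪ {0}`) commute.
[cite: Serre1972, §2.1] -/
theorem cartanShape_mul_comm (ε u v u' v' : ZMod p) :
    (!![u, ε * v; v, u] * !![u', ε * v'; v', u'] : Matrix (Fin 2) (Fin 2) (ZMod p)) =
      !![u', ε * v'; v', u'] * !![u, ε * v; v, u] := by
  rw [Matrix.mul_fin_two, Matrix.mul_fin_two]
  exact mat_eq (by ring) (by ring) (by ring) (by ring)

/-- **The non-split Cartan subgroup is commutative** (`𝔽_{p²}ˣ`). [cite: Serre1972, §2.1] -/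
theorem mul_comm_of_mem_nonsplitCartan {ε : ZMod p} {M N : Matrix (Fin 2) (Fin 2) (ZMod p)}
    (hM : M ∈ nonsplitCartan ε) (hN : N ∈ nonsplitCartan ε) : M * N = N * M := by
  obtain ⟨a, b, -, rfl⟩ := hM
  obtain ⟨c, d, -, rfl⟩ := hN
  exact cartanShape_mul_comm ε a b c d

/-- **Frobenius.** An element of the second kind conjugates the Cartan shape `u + v√ε` to `u − v√ε`:
`(c, −εd; d, −c)·(u, εv; v, u) = (u, −εv; −v, u)·(c, −εd; d, −c)`. [cite: Serre1972, §2.2] -/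
theorem coset_mul_cartanShape (ε c d u v : ZMod p) :
    (!![c, -(ε * d); d, -c] * !![u, ε * v; v, u] : Matrix (Fin 2) (Fin 2) (ZMod p)) =
      !![u, -(ε * v); -v, u] * !![c, -(ε * d); d, -c] := by
  rw [Matrix.mul_fin_two, Matrix.mul_fin_two]
  exact mat_eq (by ring) (by ring) (by ring) (by ring)

/-- **Commutant of a non-scalar Cartan element.** A matrix commuting with `(s, εt; t, s)`, `t ≠ 0`, `ε ≠ 0`, has the
Cartan shape `(u, εv; v, u)` (`u = Z₀₀`, `v = Z₁₀`): the commutant of a non-scalar `2 × 2` matrix is the algebra it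
generates. [folklore] -/
theorem eq_cartanShape_of_commute {ε s t : ZMod p} (hε0 : ε ≠ 0) (ht : t ≠ 0)
    {Z : Matrix (Fin 2) (Fin 2) (ZMod p)} (h : Z * !![s, ε * t; t, s] = !![s, ε * t; t, s] * Z) :
    Z = !![Z 0 0, ε * Z 1 0; Z 1 0, Z 0 0] := by
  have hZ : Z = !![Z 0 0, Z 0 1; Z 1 0, Z 1 1] := by
    ext i j; fin_cases i <;> fin_cases j <;> rfl
  rw [hZ, Matrix.mul_fin_two, Matrix.mul_fin_two] at h
  obtain ⟨h00, h01, -, -⟩ := entries_eq h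
  have h1 : Z 0 1 = ε * Z 1 0 := by
    have : t * (Z 0 1 - ε * Z 1 0) = 0 := by linear_combination h00
    rcases mul_eq_zero.mp this with h' | h'
    · exact absurd h' ht
    · exact sub_eq_zero.mp h'
  have h2 : Z 1 1 = Z 0 0 := by
    have : ε * t * (Z 0 0 - Z 1 1) = 0 := by linear_combination h01
    rcases mul_eq_zero.mp this with h' | h'
    · exact absurd h' (mul_ne_zero hε0 ht)
    · exact (sub_eq_zero.mp h').symm
  conv_lhs => rw [hZ, h1, h2]

/-- **Cancellation by an element of `C_ns⁺(ε)`** (all its elements are invertible). [folklore] -/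
theorem eq_zero_of_normalizer_mul_eq_zero {ε : ZMod p} (hε : ¬ IsSquare ε) {M Z : Matrix (Fin 2) (Fin 2) (ZMod p)}
    (hM : M ∈ nonsplitCartanNormalizer ε) (h : M * Z = 0) : Z = 0 := by
  have hdet : IsUnit M.det := (det_ne_zero_of_mem_nonsplitCartanNormalizer hε hM).isUnit
  have hMu : IsUnit M := (Matrix.isUnit_iff_isUnit_det M).mpr hdet
  exact (hMu.mul_right_eq_zero).mp h

/-- Cancellation on the other side. [folklore] -/
theorem eq_zero_of_mul_normalizer_eq_zero {ε : ZMod p} (hε : ¬ IsSquare ε) {M Z : Matrix (Fin 2) (Fin 2) (ZMod p)}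
    (hM : M ∈ nonsplitCartanNormalizer ε) (h : Z * M = 0) : Z = 0 := by
  have hdet : IsUnit M.det := (det_ne_zero_of_mem_nonsplitCartanNormalizer hε hM).isUnit
  have hMu : IsUnit M := (Matrix.isUnit_iff_isUnit_det M).mpr hdet
  exact (hMu.mul_left_eq_zero).mp h

/-- `Z + Z = 0 ⇒ Z = 0` for matrices over `𝔽_p`, `p` odd. [folklore] -/
theorem eq_zero_of_add_self_eq_zero (hp2 : p ≠ 2) {Z : Matrix (Fin 2) (Fin 2) (ZMod p)} (h : Z + Z = 0) :
    Z = 0 := by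
  have h2 : (2 : ZMod p) • Z = 0 := by rw [two_smul]; exact h
  rcases smul_eq_zero.mp h2 with h' | h'
  · exact absurd h' (two_ne_zero_of_ne_two hp2)
  · exact h'

/-! ## §3 Rigidity: the coset acts on the Cartan by Frobenius -/

/-- **An element of the second kind commutes with a Cartan element `(a, εb; b, a)` only if `b = 0`** (`p` odd,
`ε ≠ 0`): conjugation by it is the Frobenius `a + b√ε ↦ a − b√ε` of `𝔽_p[√ε]`, whose fixed points are the scalars.
[cite: Serre1972, §2.2] -/
theorem eq_zero_of_coset_commute (hp2 : p ≠ 2) {ε : ZMod p} (hε : ¬ IsSquare ε) {a b c d : ZMod p}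
    (hcd : (c, d) ≠ (0, 0))
    (hcomm : (!![c, -(ε * d); d, -c] * !![a, ε * b; b, a] : Matrix (Fin 2) (Fin 2) (ZMod p)) =
      !![a, ε * b; b, a] * !![c, -(ε * d); d, -c]) : b = 0 := by
  have hε0 := ne_zero_of_not_isSquare hε
  have h2 := two_ne_zero_of_ne_two hp2
  rw [Matrix.mul_fin_two, Matrix.mul_fin_two] at hcomm
  obtain ⟨h00, h01, -, -⟩ := entries_eq hcomm
  -- `(0,0)`: `ca − εdb = ac + εbd` ⇒ `2εbd = 0`; `(0,1)`: `cεb − εda = −aεd − εbc` ⇒ `2εbc = 0`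
  have hbd : b * d = 0 := by
    have : (2 : ZMod p) * ε * (b * d) = 0 := by linear_combination -h00
    rcases mul_eq_zero.mp this with h | h
    · exact absurd h (mul_ne_zero h2 hε0)
    · exact h
  have hbc : b * c = 0 := by
    have : (2 : ZMod p) * ε * (b * c) = 0 := by linear_combination h01
    rcases mul_eq_zero.mp this with h | h
    · exact absurd h (mul_ne_zero h2 hε0)
    · exact h
  by_contra hb
  have hc : c = 0 := by
    rcases mul_eq_zero.mp hbc with h | h
    · exact absurd h hb
    · exact h
  have hd : d = 0 := by
    rcases mul_eq_zero.mp hbd with h | h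
    · exact absurd h hb
    · exact h
  exact hcd (by rw [hc, hd])

/-- **Rigidity, membership form**: if `M ∈ C_ns⁺(ε) ∖ C_ns(ε)` commutes with `N = (a, εb; b, a) ∈ C_ns(ε)` then
`N` is a scalar (`N₁₀ = 0`). [cite: Serre1972, §2.2] -/
theorem apply_one_zero_eq_zero_of_commute (hp2 : p ≠ 2) {ε : ZMod p} (hε : ¬ IsSquare ε)
    {M N : Matrix (Fin 2) (Fin 2) (ZMod p)} (hM : M ∈ nonsplitCartanNormalizer ε) (hM' : M ∉ nonsplitCartan ε)
    (hN : N ∈ nonsplitCartan ε) (hcomm : M * N = N * M) : N 1 0 = 0 := by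
  obtain ⟨c, d, hcd, rfl⟩ := exists_eq_coset_of_not_mem_nonsplitCartan hM hM'
  obtain ⟨a, b, -, rfl⟩ := hN
  have hb := eq_zero_of_coset_commute hp2 hε hcd hcomm
  simp [hb]

/-- `diag(1, −1)` lies in `C_ns⁺(ε)` (second kind, `a = 1, b = 0`). [cite: Serre1972, §2.2] -/
theorem diag_mem_nonsplitCartanNormalizer (ε : ZMod p) :
    (!![(1 : ZMod p), 0; 0, -1] : Matrix (Fin 2) (Fin 2) (ZMod p)) ∈ nonsplitCartanNormalizer ε :=
  ⟨1, 0, by simp, Or.inr (mat_eq rfl (by ring) rfl rfl)⟩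

/-- … and NOT in `C_ns(ε)` when `p ≠ 2` (its diagonal entries differ). [cite: Serre1972, §2.2] -/
theorem diag_not_mem_nonsplitCartan (hp2 : p ≠ 2) (ε : ZMod p) :
    (!![(1 : ZMod p), 0; 0, -1] : Matrix (Fin 2) (Fin 2) (ZMod p)) ∉ nonsplitCartan ε := by
  rintro ⟨a, b, -, h⟩
  obtain ⟨h00, -, -, h11⟩ := entries_eq h
  have : (2 : ZMod p) = 0 := by linear_combination h00 - h11
  exact two_ne_zero_of_ne_two hp2 this

/-- The test element `x = (1, ε; 1, 1) = 1 + √ε ∈ C_ns(ε)`. [folklore] -/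
theorem testElement_mem_nonsplitCartan (ε : ZMod p) :
    (!![(1 : ZMod p), ε; 1, 1] : Matrix (Fin 2) (Fin 2) (ZMod p)) ∈ nonsplitCartan ε :=
  ⟨1, 1, by simp, by simp⟩

/-- Its square `x² = (1 + ε, 2ε; 2, 1 + ε) = (1 + ε) + 2√ε ∈ C_ns(ε)` has `(1,0)`-entry `2 ≠ 0` (`p` odd): a square of
`C_ns⁺(ε)` off the scalars. [folklore] -/
theorem testElement_sq (ε : ZMod p) :
    (!![(1 : ZMod p), ε; 1, 1] : Matrix (Fin 2) (Fin 2) (ZMod p)) * !![(1 : ZMod p), ε; 1, 1] =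
      !![1 + ε, ε * 2; 2, 1 + ε] := by
  rw [Matrix.mul_fin_two]
  exact mat_eq (by ring) (by ring) (by ring) (by ring)

/-- `x² ∈ C_ns(ε)` (`p` odd). [folklore] -/
theorem testElement_sq_mem_nonsplitCartan (hp2 : p ≠ 2) (ε : ZMod p) :
    (!![1 + ε, ε * 2; 2, 1 + ε] : Matrix (Fin 2) (Fin 2) (ZMod p)) ∈ nonsplitCartan ε :=
  ⟨1 + ε, 2, fun h => two_ne_zero_of_ne_two hp2 (congrArg Prod.snd h), rfl⟩

/-! ## §4 No transvections in `C_ns⁺(ε)` -/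

/-- **`C_ns⁺(ε)` contains no transvection** (`p` odd, `ε` a non-square): if `M ∈ C_ns⁺(ε)` and `(M − 1)² = 0` then
`M = 1`. For `M = (a, εb; b, a)`: `det(M − 1) = (a−1)² − εb²` vanishes only at `a = 1, b = 0` (anisotropy); for a coset
element `M² = (a² − εb²)·1` is a scalar, and `(M−1)² = 0 = M² − 2M + 1` makes `2M` a scalar, so `M` is a scalar — but no
scalar lies in the coset. CONSEQUENCES for crux 19606 (stated in the companion file at the level of `V[p]`): on an
`X_ns⁺(p)` row no `σ ∈ Γ_ℚ` acts on `V[p]` as a non-trivial transvection, so Kato's Thm. 13.4 (3) (a `σ` fixing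
`μ_{p^∞}` with `T_pV/(σ−1) ≅ ℤ_p`) and the Steinberg hypothesis of Fouquet–Wan's Thm. 1.1 (`dim ρ̄^{I_ℓ} = 1` at some
`ℓ ∥ N`) are both unavailable — the `pⁿ`-slack of Kobayashi's Thm. 4.1 is structural on these rows.
[cite: Kato2004Asterisque, Thm. 13.4 (3) (p. 226)] [cite: Serre1972, §2.2] -/
theorem eq_one_of_unipotent_of_mem_nonsplitCartanNormalizer (hp2 : p ≠ 2) {ε : ZMod p} (hε : ¬ IsSquare ε)
    {M : Matrix (Fin 2) (Fin 2) (ZMod p)} (hM : M ∈ nonsplitCartanNormalizer ε)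
    (hU : (M - 1) * (M - 1) = 0) : M = 1 := by
  have h2 := two_ne_zero_of_ne_two hp2
  have hε0 : ε ≠ 0 := fun h => hε ⟨0, by simp [h]⟩
  have hz : (0 : Matrix (Fin 2) (Fin 2) (ZMod p)) = !![0, 0; 0, 0] := by
    ext i j; fin_cases i <;> fin_cases j <;> rfl
  rw [Matrix.one_fin_two, hz] at hU
  obtain ⟨a, b, hab, rfl | rfl⟩ := hM
  · -- Cartan case: `(M-1)² = ((a-1) + b√ε)² = ((a-1)² + εb²) + 2(a-1)b √ε = 0`
    have hsub : (!![a, ε * b; b, a] : Matrix (Fin 2) (Fin 2) (ZMod p)) - !![1, 0; 0, 1] =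
        !![a - 1, ε * b; b, a - 1] := by
      ext i j; fin_cases i <;> fin_cases j <;> simp
    rw [hsub, Matrix.mul_fin_two] at hU
    obtain ⟨h00, -, h10, -⟩ := entries_eq hU
    -- from `2 b (a-1) = 0`: `b = 0` (else `a = 1` and then `εb² = 0`); then `(a-1)² = 0`
    have hb : b = 0 := by
      by_contra hb
      have ha1 : a - 1 = 0 := by
        have : (2 : ZMod p) * (b * (a - 1)) = 0 := by linear_combination h10
        rcases mul_eq_zero.mp this with h | h
        · exact absurd h h2
        · rcases mul_eq_zero.mp h with h' | h'
          · exact absurd h' hb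
          · exact h'
      have : ε * (b * b) = 0 := by linear_combination h00 - (a - 1) * ha1
      rcases mul_eq_zero.mp this with h | h
      · exact hε0 h
      · exact hb (mul_self_eq_zero.mp h)
    have ha : (a - 1) * (a - 1) = 0 := by linear_combination h00 - ε * b * hb
    have ha' : a = 1 := sub_eq_zero.mp (mul_self_eq_zero.mp ha)
    rw [ha', hb, Matrix.one_fin_two]
    exact mat_eq rfl (by ring) rfl rfl
  · -- coset case: entries `(0,1)`: `2εb = 0` ⇒ `b = 0`; then `(a-1)² = 0 = (a+1)²` ⇒ `2 = 0`
    exfalso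
    have hsub : (!![a, -(ε * b); b, -a] : Matrix (Fin 2) (Fin 2) (ZMod p)) - !![1, 0; 0, 1] =
        !![a - 1, -(ε * b); b, -a - 1] := by
      ext i j; fin_cases i <;> fin_cases j <;> simp
    rw [hsub, Matrix.mul_fin_two] at hU
    obtain ⟨h00, h01, -, h11⟩ := entries_eq hU
    have hb : b = 0 := by
      have : (2 : ZMod p) * (ε * b) = 0 := by linear_combination h01
      rcases mul_eq_zero.mp this with h | h
      · exact absurd h h2
      · rcases mul_eq_zero.mp h with h' | h'
        · exact absurd h' hε0
        · exact h'
    have ha1 : (a - 1) * (a - 1) = 0 := by linear_combination h00 + ε * b * hb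
    have ha2 : (a + 1) * (a + 1) = 0 := by linear_combination h11 + ε * b * hb
    have e1 : a = 1 := sub_eq_zero.mp (mul_self_eq_zero.mp ha1)
    have e2 : a + 1 = 0 := mul_self_eq_zero.mp ha2
    rw [e1] at e2
    exact h2 (by linear_combination e2)

end Summit.BirchSwinnertonDyer.BirchSwinnertonDyer.Theorems.EtaCartanField

end
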